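import Mathlib
import HarnessLib
import Summits.NavierStokesRegularity.NavierStokesRegularity.Theorems.PoloidalWindowDoorLrcModEntireRidgeGlobalBranchFrame
import Summits.NavierStokesRegularity.NavierStokesRegularity.Theorems.PoloidalWindowDoorLrcModEntireRidgeGlobalBranchUnique

/-!
# Item `LrcModEntire` (stmt-NavierStokesRegularity-20428), cells (Q4-curved)/(Q4-sonic) of the (TH) column —
# RIGIDITY OF COMPLETE PLANAR CURVES WITH PERIODIC OR CONSTANT CURVATURE (class-free geometry of the limit branch)

Cell ns-regularity-ideate, stub-worker seat ns-poloidal-K2-p2 g16 under the LEAD of item 20428 (ns-poloidal-K2-p3 g16);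
`--supports stmt-NavierStokesRegularity-20428 --as helper`.  Memo `Cruxes/LrcModEntire/T2B-g16.md` §3 (periodic base curve) and §5 (constant web curvature).

For a `C²` unit-speed curve `Γ : ℝ → ℝ³` inside the thread plane `P₀ = {y₂ = 0}` (the currency of the (Q4) package of skeleton `twist_split`:
`ContDiff ℝ 2 Γ`, `Γ s 2 = 0`, `‖deriv Γ s‖ = 1`, normal `ν = rotJ Γ′ = ![−Γ′₁, Γ′₀, 0]`):

* FRENET: `⟪Γ″, Γ′⟫ = 0`, `Γ″ = k • rotJ Γ′` with the signed curvature `k s = ⟪Γ″ s, rotJ (Γ′ s)⟫` (`deriv_deriv_eq_curvature_smul`), and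
  `(rotJ Γ′)′ = −k • Γ′` (`hasDerivAt_normal`);
* ★ PERIODIC CURVATURE ⇒ RIGID MOTION (`exists_rotation_of_periodic_curvature`): if `k(s + L) = k(s)` for all `s`, there are `a, b` with `a² + b² = 1`,
  `Γ′(s+L) = a•Γ′(s) + b•rotJ Γ′(s)` and `Γ(s+L) = a•Γ(s) + b•rotJ Γ(s) + c` for all `s` (the frame coefficients `⟪Γ′(s+L), Γ′(s)⟫`, `⟪Γ′(s+L), rotJ Γ′(s)⟫` have
  zero derivative — no ODE uniqueness theorem is needed);
* ★ THE DICHOTOMY (`translation_or_bounded_of_periodic_curvature`): either `Γ(s+L) = Γ(s) + τ` for a horizontal `τ` (rotation part trivial), or `Γ(ℝ)` is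
  BOUNDED (a non-trivial planar rotation-plus-translation has a fixed point `p`, and `‖Γ(s) − p‖` is `L`-periodic and continuous);
* ★ PROPER + PERIODIC CURVATURE ⇒ NON-ZERO TRANSLATION PERIOD (`exists_translation_period_of_tendsto`): if moreover `‖Γ s‖ → ∞` as `s → +∞` and `L ≠ 0`, then
  `Γ(s+L) = Γ(s) + τ` with `τ ≠ 0`, `τ₂ = 0`, and `Γ′(s+L) = Γ′(s)` — the input «one horizontal period» of the periodic Liouville endgame
  `…HorizontalPeriod.false_of_local_horizontalPeriod_slab` (port-2 g7) over `…PeriodicSlice` (K2-p2 g15), once Cauchy–Kovalevskaya across the web sheet has turned a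
  period of the WEB into a period of the SLICE (memo §3);
* ★ CONSTANT CURVATURE ⇒ LINE OR CIRCLE (`line_or_circle_of_constant_curvature`), and PROPER + CONSTANT CURVATURE ⇒ LINE through `Γ 0 = 0` in the v9 literal
  form `∀ s, Γ s = s • deriv Γ 0` (`isLine_of_constant_curvature_of_tendsto`) — the input of memo §5 («a complete curve of constant curvature inside a tube of Γ is a
  line»): with the properness of the limit branch (`…Q4LimitBranchProper`, this seat) the circle horn is absent.

Class-free; elementary calculus in the horizontal frame of `…RidgeGlobalBranchFrame` (`rotJ`, `horiz_expand`).
WHAT THIS IS NOT: not a claim about Navier–Stokes regularity — plane geometry for the hypothetical limit branch of research cell (Q4); items 20428 / 19708 / 27893 OPEN.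
-/

noncomputable section

-- the summit and its single sub-problem share the name (CONVENTIONS §1), as in every Theorems file
set_option linter.dupNamespace false

namespace Summit.NavierStokesRegularity.NavierStokesRegularity.Theorems.PoloidalWindowDoorLrcModEntirePlanarCurveRigidity

open Set Filter Topology Metric Function
open scoped InnerProductSpace RealInnerProductSpace ContDiff
open Summit.NavierStokesRegularity.NavierStokesRegularity.Theorems.PoloidalWindowDoorLrcModEntireRidgeGlobalBranchODE
open Summit.NavierStokesRegularity.NavierStokesRegularity.Theorems.PoloidalWindowDoorLrcModEntireRidgeGlobalBranchFrame
open Summit.NavierStokesRegularity.NavierStokesRegularity.Theorems.PoloidalWindowDoorLrcModEntireRidgeGlobalBranchUnique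

/-! ### Algebra of the quarter turn -/

/-- `rotJ` is additive. -/
theorem rotJ_add (x y : EuclideanSpace ℝ (Fin 3)) : rotJ (x + y) = rotJ x + rotJ y := by
  ext i; fin_cases i
  · simp [rotJ]; ring
  · simp [rotJ]
  · simp [rotJ]

/-- `rotJ` commutes with scalars. -/
theorem rotJ_smul (c : ℝ) (x : EuclideanSpace ℝ (Fin 3)) : rotJ (c • x) = c • rotJ x := by
  ext i; fin_cases i <;> simp [rotJ]

/-- `rotJ` of a difference. -/
theorem rotJ_sub (x y : EuclideanSpace ℝ (Fin 3)) : rotJ (x - y) = rotJ x - rotJ y := by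
  ext i; fin_cases i
  · simp [rotJ]; ring
  · simp [rotJ]
  · simp [rotJ]

/-- `rotJ ∘ rotJ = −1` on horizontal vectors. -/
theorem rotJ_rotJ {x : EuclideanSpace ℝ (Fin 3)} (hx : x 2 = 0) : rotJ (rotJ x) = -x := by
  ext i; fin_cases i <;> simp [rotJ, hx]

/-- `rotJ` is skew: `⟪rotJ x, y⟫ = −⟪x, rotJ y⟫`. -/
theorem inner_rotJ_left (x y : EuclideanSpace ℝ (Fin 3)) : ⟪rotJ x, y⟫ = -⟪x, rotJ y⟫ := by
  rw [inner_eq_sum3, inner_eq_sum3]; simp only [rotJ_apply]; ring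

/-- `rotJ` is an isometry of the plane: `⟪rotJ x, rotJ y⟫ = ⟪x, y⟫` for horizontal `x`. -/
theorem inner_rotJ_rotJ {x : EuclideanSpace ℝ (Fin 3)} (hx : x 2 = 0) (y : EuclideanSpace ℝ (Fin 3)) : ⟪rotJ x, rotJ y⟫ = ⟪x, y⟫ := by
  rw [inner_eq_sum3, inner_eq_sum3]; simp only [rotJ_apply, hx]; ring

/-- `⟪x, rotJ x⟫ = 0`. -/
theorem inner_self_rotJ (x : EuclideanSpace ℝ (Fin 3)) : ⟪x, rotJ x⟫ = 0 := by
  rw [inner_eq_sum3]; simp only [rotJ_apply]; ring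

/-- The planar "rotation" `x ↦ a•x + b•rotJ x` with `a² + b² = 1` preserves the norm of horizontal vectors. -/
theorem norm_rot_eq {x : EuclideanSpace ℝ (Fin 3)} (hx : x 2 = 0) {a b : ℝ} (hab : a ^ 2 + b ^ 2 = 1) : ‖a • x + b • rotJ x‖ = ‖x‖ := by
  have h1 : ‖a • x + b • rotJ x‖ ^ 2 = ‖x‖ ^ 2 := by
    rw [norm_sq_eq_sum3, norm_sq_eq_sum3]
    simp [rotJ, hx]
    linear_combination (x 0 ^ 2 + x 1 ^ 2) * hab
  nlinarith [norm_nonneg (a • x + b • rotJ x), norm_nonneg x]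

/-! ### Componentwise derivatives of curves in `ℝ³` -/

/-- A curve in `ℝ³` has a derivative iff each coordinate has (private bridge; Mathlib's `hasFDerivWithinAt_euclidean`). -/
theorem hasDerivAt_euclidean3 {f : ℝ → EuclideanSpace ℝ (Fin 3)} {f' : EuclideanSpace ℝ (Fin 3)} {x : ℝ} :
    HasDerivAt f f' x ↔ ∀ i, HasDerivAt (fun t => f t i) (f' i) x := by
  have h : ∀ i, (PiLp.proj 2 (fun _ : Fin 3 => ℝ) i).comp (ContinuousLinearMap.toSpanSingleton ℝ f') =
      ContinuousLinearMap.toSpanSingleton ℝ (f' i) := by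
    intro i; ext; simp
  simp only [hasDerivAt_iff_hasFDerivAt, ← hasFDerivWithinAt_univ, hasFDerivWithinAt_euclidean, h]

/-- `rotJ` commutes with differentiation along a curve. -/
theorem hasDerivAt_rotJ {g : ℝ → EuclideanSpace ℝ (Fin 3)} {g' : EuclideanSpace ℝ (Fin 3)} {t : ℝ} (hg : HasDerivAt g g' t) :
    HasDerivAt (fun t => rotJ (g t)) (rotJ g') t := by
  rw [hasDerivAt_euclidean3] at hg ⊢
  intro i
  fin_cases i
  · simpa [rotJ] using (hg 1).fun_neg
  · simpa [rotJ] using hg 0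
  · simpa [rotJ] using hasDerivAt_const t (0 : ℝ)

/-! ### Frenet formulas of a unit-speed planar curve -/

section frenet

variable {Γ : ℝ → EuclideanSpace ℝ (Fin 3)}

/-- `C²` gives derivatives of `Γ` and `Γ′` everywhere. -/
theorem hasDerivAt_of_contDiff_two (hΓ : ContDiff ℝ 2 Γ) (s : ℝ) :
    HasDerivAt Γ (deriv Γ s) s ∧ HasDerivAt (deriv Γ) (deriv (deriv Γ) s) s := by
  have h1 : Differentiable ℝ Γ := hΓ.differentiable (by norm_num)
  have h2 : ContDiff ℝ 1 (deriv Γ) := by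
    have h := hΓ; rw [show (2 : WithTop ℕ∞) = 1 + 1 by norm_num, contDiff_succ_iff_deriv] at h; exact h.2.2
  exact ⟨(h1 s).hasDerivAt, ((h2.differentiable one_ne_zero) s).hasDerivAt⟩

/-- The velocity and the acceleration of a curve inside `P₀` are horizontal. -/
theorem deriv_horizontal (hΓ : ContDiff ℝ 2 Γ) (hpl : ∀ s, Γ s 2 = 0) (s : ℝ) : deriv Γ s 2 = 0 ∧ deriv (deriv Γ) s 2 = 0 := by
  have hd : ∀ s, deriv Γ s 2 = 0 := fun s => deriv_apply_two_eq_zero (hasDerivAt_of_contDiff_two hΓ s).1 hpl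
  exact ⟨hd s, deriv_apply_two_eq_zero (hasDerivAt_of_contDiff_two hΓ s).2 hd⟩

/-- **Unit speed ⇒ the acceleration is normal:** `⟪Γ″, Γ′⟫ = 0`. -/
theorem inner_deriv_deriv_deriv_eq_zero (hΓ : ContDiff ℝ 2 Γ) (hun : ∀ s, ‖deriv Γ s‖ = 1) (s : ℝ) : ⟪deriv (deriv Γ) s, deriv Γ s⟫ = 0 := by
  have hT := (hasDerivAt_of_contDiff_two hΓ s).2
  have hip : HasDerivAt (fun t => ⟪deriv Γ t, deriv Γ t⟫) (⟪deriv Γ s, deriv (deriv Γ) s⟫ + ⟪deriv (deriv Γ) s, deriv Γ s⟫) s := hT.inner ℝ hT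
  have hconst : (fun t => ⟪deriv Γ t, deriv Γ t⟫) = fun _ => (1 : ℝ) := by
    funext t; rw [real_inner_self_eq_norm_sq, hun t]; norm_num
  rw [hconst] at hip
  have h0 := (hasDerivAt_const s (1 : ℝ)).unique hip
  have hc : ⟪deriv (deriv Γ) s, deriv Γ s⟫ = ⟪deriv Γ s, deriv (deriv Γ) s⟫ := real_inner_comm _ _
  linarith

/-- **FRENET:** `Γ″ = k • rotJ Γ′` with the signed curvature `k = ⟪Γ″, rotJ Γ′⟫`. -/
theorem deriv_deriv_eq_curvature_smul (hΓ : ContDiff ℝ 2 Γ) (hpl : ∀ s, Γ s 2 = 0) (hun : ∀ s, ‖deriv Γ s‖ = 1) (s : ℝ) :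
    deriv (deriv Γ) s = ⟪deriv (deriv Γ) s, rotJ (deriv Γ s)⟫ • rotJ (deriv Γ s) := by
  have h := horiz_expand (deriv_horizontal hΓ hpl s).2 (deriv_horizontal hΓ hpl s).1 (hun s)
  rw [inner_deriv_deriv_deriv_eq_zero hΓ hun s, zero_smul, zero_add] at h
  exact h

/-- **The normal turns with the tangent:** if `Γ″ = k • rotJ Γ′` then `(rotJ Γ′)′ = −k • Γ′`. -/
theorem hasDerivAt_normal (hΓ : ContDiff ℝ 2 Γ) (hpl : ∀ s, Γ s 2 = 0) {k : ℝ → ℝ}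
    (hk : ∀ s, deriv (deriv Γ) s = k s • rotJ (deriv Γ s)) (s : ℝ) :
    HasDerivAt (fun t => rotJ (deriv Γ t)) (-(k s) • deriv Γ s) s := by
  have h := hasDerivAt_rotJ (hasDerivAt_of_contDiff_two hΓ s).2
  rw [hk s, rotJ_smul, rotJ_rotJ (deriv_horizontal hΓ hpl s).1, smul_neg, ← neg_smul] at h
  exact h

end frenet

/-! ### Periodic curvature ⇒ rigid motion -/

section periodic

variable {Γ : ℝ → EuclideanSpace ℝ (Fin 3)}

/-- **PERIODIC CURVATURE ⇒ RIGID MOTION.**  If `Γ″ = k • rotJ Γ′` with `k(s+L) = k(s)`, then for the constants `a = ⟪Γ′(L), Γ′(0)⟫`, `b = ⟪Γ′(L), rotJ Γ′(0)⟫`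
(`a² + b² = 1`): `Γ′(s+L) = a•Γ′(s) + b•rotJ Γ′(s)` and `Γ(s+L) − (a•Γ(s) + b•rotJ Γ(s))` is constant. -/
theorem exists_rotation_of_periodic_curvature (hΓ : ContDiff ℝ 2 Γ) (hpl : ∀ s, Γ s 2 = 0) (hun : ∀ s, ‖deriv Γ s‖ = 1)
    {k : ℝ → ℝ} (hk : ∀ s, deriv (deriv Γ) s = k s • rotJ (deriv Γ s)) {L : ℝ} (hper : ∀ s, k (s + L) = k s) :
    ∃ a b : ℝ, a ^ 2 + b ^ 2 = 1 ∧ (∀ s, deriv Γ (s + L) = a • deriv Γ s + b • rotJ (deriv Γ s)) ∧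
      (∀ s, Γ (s + L) - (a • Γ s + b • rotJ (Γ s)) = Γ L - (a • Γ 0 + b • rotJ (Γ 0))) := by
  -- the frame coefficients of `Γ′(s+L)` in the frame at `s`
  set A : ℝ → ℝ := fun s => ⟪deriv Γ (s + L), deriv Γ s⟫ with hA
  set B : ℝ → ℝ := fun s => ⟪deriv Γ (s + L), rotJ (deriv Γ s)⟫ with hB
  have hT : ∀ s, HasDerivAt (deriv Γ) (deriv (deriv Γ) s) s := fun s => (hasDerivAt_of_contDiff_two hΓ s).2
  have hTL : ∀ s, HasDerivAt (fun t => deriv Γ (t + L)) (deriv (deriv Γ) (s + L)) s := fun s =>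
    (hT (s + L)).comp_add_const s L
  have hN : ∀ s, HasDerivAt (fun t => rotJ (deriv Γ t)) (-(k s) • deriv Γ s) s := hasDerivAt_normal hΓ hpl hk
  have hh : ∀ s, deriv Γ s 2 = 0 := fun s => (deriv_horizontal hΓ hpl s).1
  -- `A′ = 0`
  have hA' : ∀ s, HasDerivAt A 0 s := by
    intro s
    have h := (hTL s).inner ℝ (hT s)
    have e : ⟪deriv Γ (s + L), deriv (deriv Γ) s⟫ + ⟪deriv (deriv Γ) (s + L), deriv Γ s⟫ = 0 := by
      rw [hk s, hk (s + L), hper s, real_inner_smul_right, real_inner_smul_left, inner_rotJ_left]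
      ring
    rw [e] at h
    exact h
  -- `B′ = 0`
  have hB' : ∀ s, HasDerivAt B 0 s := by
    intro s
    have h := (hTL s).inner ℝ (hN s)
    have e : ⟪deriv Γ (s + L), -(k s) • deriv Γ s⟫ + ⟪deriv (deriv Γ) (s + L), rotJ (deriv Γ s)⟫ = 0 := by
      rw [hk (s + L), hper s, real_inner_smul_right, real_inner_smul_left, inner_rotJ_rotJ (hh (s + L))]
      ring
    rw [e] at h
    exact h
  have hAc : ∀ s, A s = A 0 := fun s =>
    is_const_of_deriv_eq_zero (fun t => (hA' t).differentiableAt) (fun t => (hA' t).deriv) s 0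
  have hBc : ∀ s, B s = B 0 := fun s =>
    is_const_of_deriv_eq_zero (fun t => (hB' t).differentiableAt) (fun t => (hB' t).deriv) s 0
  refine ⟨A 0, B 0, ?_, ?_, ?_⟩
  · -- `a² + b² = ‖Γ′(L)‖² = 1`
    have hexp := horiz_expand (hh (0 + L)) (hh 0) (hun 0)
    have hn : ‖deriv Γ (0 + L)‖ ^ 2 = 1 := by rw [hun]; norm_num
    rw [hexp, norm_sq_eq_sum3] at hn
    have hab := sq_add_sq_of_horizontal_unit (hh 0) (hun 0)
    simp only [PiLp.add_apply, PiLp.smul_apply, smul_eq_mul, (rotJ_apply _).1, (rotJ_apply _).2.1, (rotJ_apply _).2.2, hh 0,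
      mul_zero, add_zero] at hn
    have : A 0 ^ 2 + B 0 ^ 2 = (A 0 ^ 2 + B 0 ^ 2) * (deriv Γ 0 0 ^ 2 + deriv Γ 0 1 ^ 2) := by rw [hab, mul_one]
    rw [this]; nlinarith [hn]
  · intro s
    have hexp := horiz_expand (hh (s + L)) (hh s) (hun s)
    rw [hexp]
    change A s • deriv Γ s + B s • rotJ (deriv Γ s) = A 0 • deriv Γ s + B 0 • rotJ (deriv Γ s)
    rw [hAc s, hBc s]
  · -- the difference `Γ(s+L) − rot(Γ(s))` has zero derivative
    have hG : ∀ s, HasDerivAt Γ (deriv Γ s) s := fun s => (hasDerivAt_of_contDiff_two hΓ s).1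
    have hD : ∀ s, HasDerivAt (fun t => Γ (t + L) - (A 0 • Γ t + B 0 • rotJ (Γ t))) 0 s := by
      intro s
      have hGL : HasDerivAt (fun t => Γ (t + L)) (deriv Γ (s + L)) s := (hG (s + L)).comp_add_const s L
      have h := hGL.fun_sub (((hG s).fun_const_smul (A 0)).fun_add ((hasDerivAt_rotJ (hG s)).fun_const_smul (B 0)))
      have e : deriv Γ (s + L) - (A 0 • deriv Γ s + B 0 • rotJ (deriv Γ s)) = 0 := by
        rw [sub_eq_zero]
        have hexp := horiz_expand (hh (s + L)) (hh s) (hun s)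
        rw [hexp]
        change A s • deriv Γ s + B s • rotJ (deriv Γ s) = A 0 • deriv Γ s + B 0 • rotJ (deriv Γ s)
        rw [hAc s, hBc s]
      rw [e] at h
      exact h
    intro s
    exact is_const_of_deriv_eq_zero (fun t => (hD t).differentiableAt) (fun t => (hD t).deriv) s 0
      |>.trans (by simp)

/-- A continuous `L`-periodic real function (`L ≠ 0`) is bounded. -/
theorem exists_bound_of_periodic {g : ℝ → ℝ} (hg : Continuous g) {L : ℝ} (hL : L ≠ 0) (hper : ∀ s, g (s + L) = g s) :
    ∃ B : ℝ, ∀ s, |g s| ≤ B := by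
  have hP : Function.Periodic g |L| := by
    rcases le_or_gt 0 L with h | h
    · rw [abs_of_nonneg h]; exact fun s => hper s
    · rw [abs_of_neg h]
      intro s
      have := hper (s + -L)
      rw [show s + -L + L = s by ring] at this
      exact this.symm
  obtain ⟨B, hB⟩ := (isCompact_Icc (a := (0 : ℝ)) (b := |L|)).exists_bound_of_continuousOn hg.continuousOn
  refine ⟨B, fun s => ?_⟩
  obtain ⟨y, hy, hsy⟩ := hP.exists_mem_Ico₀ (abs_pos.2 hL) s
  rw [hsy]
  exact hB y (Ico_subset_Icc_self hy)

/-- **THE DICHOTOMY: translation period, or bounded trace.**  Under periodic curvature, either `Γ(s+L) = Γ(s) + τ` with `τ` horizontal and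
`Γ′(s+L) = Γ′(s)`, or `Γ(ℝ)` is bounded. -/
theorem translation_or_bounded_of_periodic_curvature (hΓ : ContDiff ℝ 2 Γ) (hpl : ∀ s, Γ s 2 = 0) (hun : ∀ s, ‖deriv Γ s‖ = 1)
    {k : ℝ → ℝ} (hk : ∀ s, deriv (deriv Γ) s = k s • rotJ (deriv Γ s)) {L : ℝ} (hL : L ≠ 0) (hper : ∀ s, k (s + L) = k s) :
    (∃ τ : EuclideanSpace ℝ (Fin 3), τ 2 = 0 ∧ (∀ s, Γ (s + L) = Γ s + τ) ∧ (∀ s, deriv Γ (s + L) = deriv Γ s)) ∨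
      (∃ B : ℝ, ∀ s, ‖Γ s‖ ≤ B) := by
  obtain ⟨a, b, hab, hT, hΓL⟩ := exists_rotation_of_periodic_curvature hΓ hpl hun hk hper
  set c : EuclideanSpace ℝ (Fin 3) := Γ L - (a • Γ 0 + b • rotJ (Γ 0)) with hc
  have hmot : ∀ s, Γ (s + L) = a • Γ s + b • rotJ (Γ s) + c := fun s => by
    have h := hΓL s; rw [sub_eq_iff_eq_add'] at h; rw [h]
  have hc2 : c 2 = 0 := by simp [hc, hpl, rotJ]
  by_cases ha : a = 1
  · -- trivial rotation part: a translation
    have hb : b = 0 := by rw [ha] at hab; nlinarith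
    left
    refine ⟨c, hc2, fun s => ?_, fun s => ?_⟩
    · rw [hmot s, ha, hb]; simp
    · rw [hT s, ha, hb]; simp
  · -- non-trivial rotation: fixed point `p`, then `‖Γ(s) − p‖` is `L`-periodic
    right
    have hD : 0 < (1 - a) ^ 2 + b ^ 2 := by
      have : 0 < (1 - a) ^ 2 := by positivity
      positivity
    set D : ℝ := (1 - a) ^ 2 + b ^ 2 with hDdef
    set p : EuclideanSpace ℝ (Fin 3) := WithLp.toLp 2 ![((1 - a) * c 0 - b * c 1) / D, ((1 - a) * c 1 + b * c 0) / D, 0] with hp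
    have hp2 : p 2 = 0 := by simp [hp]
    have hfix : a • p + b • rotJ p + c = p := by
      have hD0 : D ≠ 0 := hD.ne'
      ext i; fin_cases i
      · simp [hp, rotJ]; field_simp; ring
      · simp [hp, rotJ]; field_simp; ring
      · simp [hp, rotJ, hc2]
    have hrel : ∀ s, Γ (s + L) - p = a • (Γ s - p) + b • rotJ (Γ s - p) := fun s => by
      rw [hmot s, rotJ_sub, smul_sub, smul_sub]
      conv_lhs => rw [← hfix]
      abel
    have hnorm : ∀ s, ‖Γ (s + L) - p‖ = ‖Γ s - p‖ := fun s => by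
      rw [hrel s]; exact norm_rot_eq (by simp [hpl, hp2]) hab
    have hcont : Continuous fun s => ‖Γ s - p‖ := (hΓ.continuous.sub continuous_const).norm
    obtain ⟨B, hB⟩ := exists_bound_of_periodic hcont hL hnorm
    refine ⟨B + ‖p‖, fun s => ?_⟩
    have h1 : ‖Γ s‖ ≤ ‖Γ s - p‖ + ‖p‖ := by
      have := norm_add_le (Γ s - p) p; simpa using this
    have h2 : ‖Γ s - p‖ ≤ B := by have := hB s; rwa [abs_of_nonneg (norm_nonneg _)] at this
    linarith

/-- ★ **PROPER + PERIODIC CURVATURE ⇒ A NON-ZERO HORIZONTAL TRANSLATION PERIOD.**  If in addition `‖Γ s‖ → ∞` as `s → +∞` (the limit branch is proper,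
`…Q4LimitBranchProper`) then `Γ(s+L) = Γ(s) + τ` with `τ ≠ 0`, `τ₂ = 0`, `Γ′(s+L) = Γ′(s)`. -/
theorem exists_translation_period_of_tendsto (hΓ : ContDiff ℝ 2 Γ) (hpl : ∀ s, Γ s 2 = 0) (hun : ∀ s, ‖deriv Γ s‖ = 1)
    {k : ℝ → ℝ} (hk : ∀ s, deriv (deriv Γ) s = k s • rotJ (deriv Γ s)) {L : ℝ} (hL : L ≠ 0) (hper : ∀ s, k (s + L) = k s)
    (hprop : Tendsto (fun s => ‖Γ s‖) atTop atTop) :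
    ∃ τ : EuclideanSpace ℝ (Fin 3), τ ≠ 0 ∧ τ 2 = 0 ∧ (∀ s, Γ (s + L) = Γ s + τ) ∧ (∀ s, deriv Γ (s + L) = deriv Γ s) := by
  have hunb : ¬ ∃ B : ℝ, ∀ s, ‖Γ s‖ ≤ B := by
    rintro ⟨B, hB⟩
    obtain ⟨s, hs⟩ := (hprop.eventually (eventually_gt_atTop B)).exists
    exact absurd (hB s) (not_le.2 hs)
  rcases translation_or_bounded_of_periodic_curvature hΓ hpl hun hk hL hper with ⟨τ, hτ2, hτ, hτ'⟩ | hbdd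
  · refine ⟨τ, ?_, hτ2, hτ, hτ'⟩
    rintro rfl
    -- `τ = 0`: `Γ` is `L`-periodic, hence bounded
    apply hunb
    have hcont : Continuous fun s => ‖Γ s‖ := hΓ.continuous.norm
    obtain ⟨B, hB⟩ := exists_bound_of_periodic hcont hL (fun s => by rw [hτ s, add_zero])
    exact ⟨B, fun s => by have := hB s; rwa [abs_of_nonneg (norm_nonneg _)] at this⟩
  · exact absurd hbdd hunb

end periodic

/-! ### Constant curvature ⇒ line or circle -/

section constant

variable {Γ : ℝ → EuclideanSpace ℝ (Fin 3)}

/-- **CONSTANT CURVATURE ⇒ LINE OR CIRCLE.**  If `Γ″ = k₀ • rotJ Γ′` with a constant `k₀`: either `k₀ = 0` and `Γ s = Γ 0 + s • Γ′ 0`, or `k₀ ≠ 0` and `Γ` stays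
on the circle of radius `|k₀|⁻¹` about the (constant) centre `Γ s + k₀⁻¹ • rotJ Γ′(s)`. -/
theorem line_or_circle_of_constant_curvature (hΓ : ContDiff ℝ 2 Γ) (hpl : ∀ s, Γ s 2 = 0) (hun : ∀ s, ‖deriv Γ s‖ = 1)
    {k₀ : ℝ} (hk : ∀ s, deriv (deriv Γ) s = k₀ • rotJ (deriv Γ s)) :
    (k₀ = 0 ∧ ∀ s, Γ s = Γ 0 + s • deriv Γ 0) ∨
      (k₀ ≠ 0 ∧ ∃ p : EuclideanSpace ℝ (Fin 3), p 2 = 0 ∧ ∀ s, ‖Γ s - p‖ = |k₀|⁻¹) := by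
  have hG : ∀ s, HasDerivAt Γ (deriv Γ s) s := fun s => (hasDerivAt_of_contDiff_two hΓ s).1
  have hT : ∀ s, HasDerivAt (deriv Γ) (deriv (deriv Γ) s) s := fun s => (hasDerivAt_of_contDiff_two hΓ s).2
  have hh : ∀ s, deriv Γ s 2 = 0 := fun s => (deriv_horizontal hΓ hpl s).1
  by_cases hk0 : k₀ = 0
  · left
    refine ⟨hk0, ?_⟩
    -- `Γ′` is constant, then `Γ s − s • Γ′ 0` is constant
    have hTc : ∀ s, deriv Γ s = deriv Γ 0 := fun s =>
      is_const_of_deriv_eq_zero (fun t => (hT t).differentiableAt) (fun t => by rw [(hT t).deriv, hk t, hk0, zero_smul]) s 0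
    have hD : ∀ s, HasDerivAt (fun t => Γ t - t • deriv Γ 0) 0 s := by
      intro s
      have h := (hG s).fun_sub ((hasDerivAt_id s).smul_const (deriv Γ 0))
      rw [hTc s] at h
      simpa using h
    intro s
    have h := is_const_of_deriv_eq_zero (fun t => (hD t).differentiableAt) (fun t => (hD t).deriv) s 0
    simp only [zero_smul, sub_zero] at h
    rw [← h]; abel
  · right
    refine ⟨hk0, ?_⟩
    -- the centre `Γ s + k₀⁻¹ • rotJ Γ′(s)` is constant
    have hN : ∀ s, HasDerivAt (fun t => rotJ (deriv Γ t)) (-k₀ • deriv Γ s) s := hasDerivAt_normal hΓ hpl hk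
    have hC : ∀ s, HasDerivAt (fun t => Γ t + k₀⁻¹ • rotJ (deriv Γ t)) 0 s := by
      intro s
      have h := (hG s).fun_add ((hN s).fun_const_smul k₀⁻¹)
      have e : deriv Γ s + k₀⁻¹ • (-k₀ • deriv Γ s) = 0 := by
        rw [smul_smul, show k₀⁻¹ * -k₀ = -1 by field_simp, neg_one_smul, add_neg_cancel]
      rw [e] at h
      exact h
    set p : EuclideanSpace ℝ (Fin 3) := Γ 0 + k₀⁻¹ • rotJ (deriv Γ 0) with hp
    have hpc : ∀ s, Γ s + k₀⁻¹ • rotJ (deriv Γ s) = p := fun s =>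
      is_const_of_deriv_eq_zero (fun t => (hC t).differentiableAt) (fun t => (hC t).deriv) s 0
    refine ⟨p, by simp [hp, hpl, rotJ], fun s => ?_⟩
    have e : Γ s - p = -(k₀⁻¹ • rotJ (deriv Γ s)) := by rw [← hpc s]; abel
    rw [e, norm_neg, norm_smul, (rotJ_facts (hh s) (hun s)).2.1, mul_one, norm_inv, Real.norm_eq_abs]

/-- ★ **PROPER + CONSTANT CURVATURE ⇒ A LINE** (v9 literal `∀ s, Γ s = s • deriv Γ 0`, with `Γ 0 = 0`). -/
theorem isLine_of_constant_curvature_of_tendsto (hΓ : ContDiff ℝ 2 Γ) (hpl : ∀ s, Γ s 2 = 0) (hun : ∀ s, ‖deriv Γ s‖ = 1)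
    (hΓ0 : Γ 0 = 0) {k₀ : ℝ} (hk : ∀ s, deriv (deriv Γ) s = k₀ • rotJ (deriv Γ s))
    (hprop : Tendsto (fun s => ‖Γ s‖) atTop atTop) : ∀ s, Γ s = s • deriv Γ 0 := by
  rcases line_or_circle_of_constant_curvature hΓ hpl hun hk with ⟨-, hline⟩ | ⟨-, p, -, hcirc⟩
  · intro s; rw [hline s, hΓ0, zero_add]
  · exfalso
    have hbdd : ∀ s, ‖Γ s‖ ≤ |k₀|⁻¹ + ‖p‖ := fun s => by
      have h1 : ‖Γ s‖ ≤ ‖Γ s - p‖ + ‖p‖ := by have := norm_add_le (Γ s - p) p; simpa using this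
      rw [hcirc s] at h1; exact h1
    obtain ⟨s, hs⟩ := (hprop.eventually (eventually_gt_atTop (|k₀|⁻¹ + ‖p‖))).exists
    exact absurd (hbdd s) (not_le.2 hs)

/-- **Curvature-function version**: if `Γ″ = k • rotJ Γ′` for a CONSTANT function `k` (`k s = k 0`), a proper `Γ` through `0` is the line `s ↦ s • Γ′(0)`. -/
theorem isLine_of_curvature_const_of_tendsto (hΓ : ContDiff ℝ 2 Γ) (hpl : ∀ s, Γ s 2 = 0) (hun : ∀ s, ‖deriv Γ s‖ = 1)
    (hΓ0 : Γ 0 = 0) {k : ℝ → ℝ} (hk : ∀ s, deriv (deriv Γ) s = k s • rotJ (deriv Γ s)) (hconst : ∀ s, k s = k 0)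
    (hprop : Tendsto (fun s => ‖Γ s‖) atTop atTop) : ∀ s, Γ s = s • deriv Γ 0 :=
  isLine_of_constant_curvature_of_tendsto hΓ hpl hun hΓ0 (k₀ := k 0) (fun s => by rw [hk s, hconst s]) hprop

end constant

end Summit.NavierStokesRegularity.NavierStokesRegularity.Theorems.PoloidalWindowDoorLrcModEntirePlanarCurveRigidity
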